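import Mathlib
import Summits.ValiantsHypothesis.ValiantsHypothesis.Theorems.RigidityForcesSymmetryRankRigidMinimalReprLaplaceFiveSeparatedCaptureTwoTerm
import Summits.ValiantsHypothesis.ValiantsHypothesis.Theorems.RigidityForcesSymmetryRankRigidMinimalReprLaplaceFiveSeparatedCaptureTwoK2Hub
import Summits.ValiantsHypothesis.ValiantsHypothesis.Theorems.RigidityForcesSymmetryRankRigidMinimalReprLaplaceFiveSeparatedCaptureLeadingMonomials

/-!
# ValiantsHypothesis / RigidityForcesSymmetry — crux `LaplaceOptimalFive` (stmt-ValiantsHypothesis-24813), symmetric capture: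
# ★★ **THE MONOMIAL SECTOR OF `CaptureIneqSym` IS A THEOREM** (T2 of record, crit-3 g7 06:10:49Z / director R401 (3) / desk #540 (C))

Memo `pub/val-lit/lmr/NOTE-p4g17-24813-K32-symmetric-capture.md` §3b (val-lit-p4 g17; refereed PASS AS PAPER by crit-3 g7): if each
of the three triangle spans `U₀₁, U₀₂, U₁₂` is MONOMIAL — with every element `u` and every letter pair it also contains the pair
indicator `monoMat x y` whenever `u x y ≠ 0` (the `T⁵`-stable = monomially spanned subspaces of symmetric matrices) — then every space
`W` of symmetric zero-diagonal leaf matrices whose obligations are captured by `L₃(U₀₁,U₀₂,U₁₂)` has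
`finrank W ≤ finrank U₀₁ + finrank U₀₂ + finrank U₁₂`.  This sector contains all 33 097 equality cases of kit j325676 (the Laplace atoms).

Proof (the memo's charging argument, read in the tree's tensor currency):
* a sorted letter triple `t = (a<b<c)` is CHARGED (`∃ μ ∈ W, T_μ(a,b,c) ≠ 0`) only if, writing `T_μ` in the finite form
  `A_r(p,q) + B_q(p,r) + C_p(q,r)` (✓ `L3_finite_form`) and evaluating at the three EVEN permutations `(a,b,c), (b,c,a), (c,a,b)` (all equal
  to `T_μ(a,b,c) ≠ 0` by ✓ `contractZ_swap12/23`), each of the three equations has a nonzero term, and a nonzero term makes its CELL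
  available — cell `(v, k)`: the pair `t ∖ {k-th letter}` lies (as `monoMat`) in the span attached to vector slot `v`; the three even
  transversals partition the `3 × 3` grid of cells, so a charged triple has ≥ 3 available cells (`three_le_card_cells`);
* double counting: `Σ_t #cells(t) = 3·(#pairs(U₁₂) + #pairs(U₀₂) + #pairs(U₀₁))` (`fiber_three`: each pair is the complement of a letter in
  exactly 3 sorted triples — `decide`), and `#pairs(U) ≤ finrank U` (distinct pair indicators have distinct leading monomials,
  ✓ `card_LM_le_finrank`);
* `μ ↦ (T_μ(t))_{t charged}` is injective on `W` (✓ `contractZ_rep12`, ✓ `hub_injective`), so `finrank W ≤ #charged ≤ Σ finrank U`.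

Main declarations: `monoMat`, `Tri`, `triPair`, `fiber_three`, `contractZ_sorted_eq_zero`, `three_le_card_cells`,
★★ `captureIneqSym_of_monomial`.

Honest framing (label pre-stated by crit-3 g7): T2 ported closes NOTHING on 24813 by itself — the symmetric capture inequality for
mixed (non-monomial, `Ω ≠ 0`) configurations stays the OPEN wall; K1 on `K₃ ⊔ K₂`, S2′, `LaplaceOptimalFive` (OPEN · CONTESTED 72/120),
`RankRigidMinimalRepr`, `VP ≠ VNP` are NOT proved.  Local bookkeeping `def`s only (a pair indicator, an index type, a pair selector,
a cell predicate); no structure / instance / notation / axiom; Mathlib + tree only.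
-/

set_option linter.dupNamespace false
set_option autoImplicit false

namespace Summit.ValiantsHypothesis.ValiantsHypothesis.Theorems.RigidityForcesSymmetryRankRigidMinimalRepr

namespace LaplaceFiveSeparatedCapture

open Finset LaplaceFiveSectorSplit

noncomputable section

/-! ### Pair indicators and monomial spans -/

/-- The PAIR INDICATOR `monoMat x y`: the symmetric matrix with `1` at `(x,y)` and `(y,x)` and `0` elsewhere
(for `x = y` the single diagonal entry). -/
def monoMat (x y : Fin 5) : Fin 5 → Fin 5 → ℂ := fun p q => if (p = x ∧ q = y) ∨ (p = y ∧ q = x) then 1 else 0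

/-- `monoMat x y = monoMat y x`. [folklore] -/
lemma monoMat_comm (x y : Fin 5) : monoMat x y = monoMat y x := by
  funext p q; simp only [monoMat]; congr 1; exact propext or_comm

/-- The entry of `monoMat x y` at `(x, y)` is `1`. [folklore] -/
lemma monoMat_self (x y : Fin 5) : monoMat x y x y = 1 := by simp [monoMat]

/-- `monoMat x y` vanishes at every upper position other than `(x, y)` (`x ≤ y`, `i ≤ j`). [folklore] -/
lemma monoMat_eq_zero_of_ne {x y i j : Fin 5} (hxy : x ≤ y) (hij : i ≤ j) (h : (i, j) ≠ (x, y)) :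
    monoMat x y i j = 0 := by
  simp only [monoMat]
  rw [if_neg]
  intro hor
  rcases hor with ⟨hi, hj⟩ | ⟨hi, hj⟩
  · exact h (by rw [hi, hj])
  · have hyx : y ≤ x := by rw [← hi, ← hj]; exact hij
    have hxy' : x = y := le_antisymm hxy hyx
    apply h; rw [hi, hj, hxy']

/-- The degree of a pair indicator: `deg (monoMat x y) = wt (x,y) + 1` for `x ≤ y`. [folklore] -/
lemma deg_monoMat {x y : Fin 5} (hxy : x ≤ y) : deg (monoMat x y) = wt ⟨(x, y), hxy⟩ + 1 := by
  apply le_antisymm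
  · apply Finset.sup_le
    intro m hm
    rw [mem_jsupp] at hm
    have : m = ⟨(x, y), hxy⟩ := by
      by_contra hne
      apply hm
      apply monoMat_eq_zero_of_ne hxy m.2
      intro h; apply hne; exact Subtype.ext h
    rw [this]
  · have h1 : monoMat x y x y ≠ 0 := by rw [monoMat_self]; exact one_ne_zero
    have := wt_lt_deg_of_ne (m := ⟨(x, y), hxy⟩) h1
    omega

open scoped Classical in
/-- DISTINCT PAIR INDICATORS IN `U` ARE INDEPENDENT: the number of upper positions `x ≤ y` with `monoMat x y ∈ U` is at most
`finrank U` (each such position is a leading monomial of `U`, ✓ `card_LM_le_finrank`). [folklore] -/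
lemma card_monoMat_mem_le_finrank (U : Submodule ℂ (Fin 5 → Fin 5 → ℂ)) (hU : ∀ u ∈ U, ∀ p q, u p q = u q p) :
    (Finset.univ.filter (fun g : P => monoMat g.1.1 g.1.2 ∈ U)).card ≤ Module.finrank ℂ U := by
  classical
  let e : P → J := fun g => ⟨g.1, le_of_lt g.2⟩
  have he : Function.Injective e := by
    intro g g' h
    apply Subtype.ext
    exact congrArg (fun m : J => m.1) h
  have hsub : (Finset.univ.filter (fun g : P => monoMat g.1.1 g.1.2 ∈ U)).map ⟨e, he⟩ ⊆ LM U := by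
    intro m hm
    rw [Finset.mem_map] at hm
    obtain ⟨g, hg, rfl⟩ := hm
    have hgU := (Finset.mem_filter.mp hg).2
    exact lead_mem_LM hgU (deg_monoMat (le_of_lt g.2))
  have := Finset.card_le_card hsub
  rw [Finset.card_map] at this
  exact this.trans (card_LM_le_finrank U hU)

/-! ### Sorted letter triples, their complementary pairs, and the fibre count -/

/-- Sorted letter triples `a < b < c` (the ten 3-subsets of the letters). -/
abbrev Tri : Type := {t : Fin 5 × Fin 5 × Fin 5 // t.1 < t.2.1 ∧ t.2.1 < t.2.2}

/-- The complementary pair of the `k`-th letter of a sorted triple `(a,b,c)`: `k = 0 ↦ (b,c)`, `k = 1 ↦ (a,c)`, `k = 2 ↦ (a,b)`. -/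
def triPair (t : Tri) (k : Fin 3) : P :=
  if k = 0 then ⟨(t.1.2.1, t.1.2.2), t.2.2⟩
  else if k = 1 then ⟨(t.1.1, t.1.2.2), lt_trans t.2.1 t.2.2⟩
  else ⟨(t.1.1, t.1.2.1), t.2.1⟩

set_option maxHeartbeats 800000 in
/-- Every pair `x < y` is the complementary pair of a letter in EXACTLY THREE (sorted triple, position) pairs. [folklore] -/
lemma fiber_three : ∀ g : P, (Finset.univ.filter (fun x : Tri × Fin 3 => triPair x.1 x.2 = g)).card = 3 := by
  decide

/-- FIBRE COUNT: for any property `Φ` of pairs, `#{(t,k) : Φ (triPair t k)} = 3 · #{g : Φ g}`. [folklore] -/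
lemma card_filter_triPair (Φ : P → Prop) [DecidablePred Φ] :
    (Finset.univ.filter (fun x : Tri × Fin 3 => Φ (triPair x.1 x.2))).card = 3 * (Finset.univ.filter Φ).card := by
  classical
  rw [Finset.card_eq_sum_card_fiberwise (f := fun x : Tri × Fin 3 => triPair x.1 x.2) (t := Finset.univ.filter Φ)
    (fun x hx => Finset.mem_filter.mpr ⟨Finset.mem_univ _, (Finset.mem_filter.mp hx).2⟩)]
  have hfib : ∀ g ∈ Finset.univ.filter Φ,
      ((Finset.univ.filter (fun x : Tri × Fin 3 => Φ (triPair x.1 x.2))).filter (fun x => triPair x.1 x.2 = g)).card = 3 := by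
    intro g hg
    have hΦ : Φ g := (Finset.mem_filter.mp hg).2
    refine Eq.trans ?_ (fiber_three g)
    congr 1
    ext x
    simp only [Finset.mem_filter, Finset.mem_univ, true_and]
    constructor
    · exact fun h => h.2
    · intro h; exact ⟨h ▸ hΦ, h⟩
  rw [Finset.sum_congr rfl hfib, Finset.sum_const, smul_eq_mul, mul_comm]

/-! ### A symmetric repeated-letter-free tensor is determined by its sorted entries -/

/-- A tensor symmetric under the slot transpositions `(0 1)`, `(1 2)` that vanishes at repeated letters and at every SORTED
triple vanishes identically. [folklore] -/
lemma eq_zero_of_sorted {T : Fin 5 → Fin 5 → Fin 5 → ℂ} (h12 : ∀ p q r, T q p r = T p q r)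
    (h23 : ∀ p q r, T p r q = T p q r) (hrep : ∀ p r, T p p r = 0)
    (hsorted : ∀ t : Tri, T t.1.1 t.1.2.1 t.1.2.2 = 0) (p q r : Fin 5) : T p q r = 0 := by
  have h13 : ∀ p q r, T r q p = T p q r := fun p q r => ((h12 q r p).trans (h23 q p r)).trans (h12 p q r)
  by_cases hpq : p = q
  · subst hpq; exact hrep p r
  by_cases hqr : q = r
  · subst hqr; rw [h13 q q p]; exact hrep q p
  by_cases hpr : p = r
  · subst hpr; rw [h23 p p q]; exact hrep p q
  rcases lt_or_gt_of_ne hpq with h1 | h1 <;> rcases lt_or_gt_of_ne hqr with h2 | h2 <;>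
    rcases lt_or_gt_of_ne hpr with h3 | h3
  · exact hsorted ⟨(p, q, r), h1, h2⟩
  · exact (lt_asymm (h1.trans h2) h3).elim
  · have h := hsorted ⟨(p, r, q), h3, h2⟩
    simp only at h; rwa [h23 p q r] at h
  · have h := hsorted ⟨(r, p, q), h3, h1⟩
    simp only at h; rwa [h23 r q p, h13 p q r] at h
  · have h := hsorted ⟨(q, p, r), h1, h3⟩
    simp only at h; rwa [h12 p q r] at h
  · have h := hsorted ⟨(q, r, p), h2, h3⟩
    simp only at h; rwa [h23 q p r, h12 p q r] at h
  · exact (lt_asymm (h2.trans h1) h3).elim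
  · have h := hsorted ⟨(r, q, p), h2, h1⟩
    simp only at h; rwa [h13 p q r] at h

/-! ### Cells of a sorted triple and the three even transversals -/

open scoped Classical in
/-- Positions `k` whose complementary pair (as a pair indicator) lies in `U`. -/
def Kset (U : Submodule ℂ (Fin 5 → Fin 5 → ℂ)) (t : Tri) : Finset (Fin 3) :=
  Finset.univ.filter (fun k => monoMat (triPair t k).1.1 (triPair t k).1.2 ∈ U)

/-- AVAILABLE CELLS of a sorted triple: `(v, k)` with the complementary pair of the `k`-th letter in the span attached to vector
slot `v` (`v = 0 ↔ U₁₂`, `v = 1 ↔ U₀₂`, `v = 2 ↔ U₀₁`). -/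
def cells (U01 U02 U12 : Submodule ℂ (Fin 5 → Fin 5 → ℂ)) (t : Tri) : Finset (Fin 3 × Fin 3) :=
  (Kset U12 t).map (Function.Embedding.sectR (0 : Fin 3) (Fin 3)) ∪
    (Kset U02 t).map (Function.Embedding.sectR (1 : Fin 3) (Fin 3)) ∪
    (Kset U01 t).map (Function.Embedding.sectR (2 : Fin 3) (Fin 3))

/-- Membership of a slot-`0` cell. [folklore] -/
lemma mem_cells_zero {U01 U02 U12 : Submodule ℂ (Fin 5 → Fin 5 → ℂ)} {t : Tri} {k : Fin 3}
    (h : monoMat (triPair t k).1.1 (triPair t k).1.2 ∈ U12) : ((0 : Fin 3), k) ∈ cells U01 U02 U12 t := by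
  classical
  unfold cells
  refine Finset.mem_union_left _ (Finset.mem_union_left _ ?_)
  exact Finset.mem_map.mpr ⟨k, Finset.mem_filter.mpr ⟨Finset.mem_univ k, h⟩, rfl⟩

/-- Membership of a slot-`1` cell. [folklore] -/
lemma mem_cells_one {U01 U02 U12 : Submodule ℂ (Fin 5 → Fin 5 → ℂ)} {t : Tri} {k : Fin 3}
    (h : monoMat (triPair t k).1.1 (triPair t k).1.2 ∈ U02) : ((1 : Fin 3), k) ∈ cells U01 U02 U12 t := by
  classical
  unfold cells
  refine Finset.mem_union_left _ (Finset.mem_union_right _ ?_)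
  exact Finset.mem_map.mpr ⟨k, Finset.mem_filter.mpr ⟨Finset.mem_univ k, h⟩, rfl⟩

/-- Membership of a slot-`2` cell. [folklore] -/
lemma mem_cells_two {U01 U02 U12 : Submodule ℂ (Fin 5 → Fin 5 → ℂ)} {t : Tri} {k : Fin 3}
    (h : monoMat (triPair t k).1.1 (triPair t k).1.2 ∈ U01) : ((2 : Fin 3), k) ∈ cells U01 U02 U12 t := by
  classical
  unfold cells
  refine Finset.mem_union_right _ ?_
  exact Finset.mem_map.mpr ⟨k, Finset.mem_filter.mpr ⟨Finset.mem_univ k, h⟩, rfl⟩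

/-- The number of cells is at most the sum of the three position counts. [folklore] -/
lemma card_cells_le (U01 U02 U12 : Submodule ℂ (Fin 5 → Fin 5 → ℂ)) (t : Tri) :
    (cells U01 U02 U12 t).card ≤ (Kset U12 t).card + (Kset U02 t).card + (Kset U01 t).card := by
  unfold cells
  refine (Finset.card_union_le _ _).trans ?_
  refine (Nat.add_le_add_right (Finset.card_union_le _ _) _).trans ?_
  simp only [Finset.card_map]
  exact le_rfl

/-- Three pairwise distinct members force `3 ≤ #S`. [folklore] -/
lemma three_le_card_of_mem {S : Finset (Fin 3 × Fin 3)} {x y z : Fin 3 × Fin 3} (hxy : x ≠ y) (hxz : x ≠ z) (hyz : y ≠ z)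
    (hx : x ∈ S) (hy : y ∈ S) (hz : z ∈ S) : 3 ≤ S.card := by
  have hsub : ({x, y, z} : Finset (Fin 3 × Fin 3)) ⊆ S := by
    intro w hw
    simp only [Finset.mem_insert, Finset.mem_singleton] at hw
    rcases hw with rfl | rfl | rfl
    · exact hx
    · exact hy
    · exact hz
  have h3 : ({x, y, z} : Finset (Fin 3 × Fin 3)).card = 3 := Finset.card_eq_three.mpr ⟨x, y, z, hxy, hxz, hyz, rfl⟩
  have h := Finset.card_le_card hsub
  rw [h3] at h
  exact h

open scoped Classical in
/-- The sum of the position counts over all sorted triples is three times the number of pair indicators in `U`. [folklore] -/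
lemma sum_card_Kset (U : Submodule ℂ (Fin 5 → Fin 5 → ℂ)) :
    ∑ t : Tri, (Kset U t).card = 3 * (Finset.univ.filter (fun g : P => monoMat g.1.1 g.1.2 ∈ U)).card := by
  classical
  rw [← card_filter_triPair (fun g : P => monoMat g.1.1 g.1.2 ∈ U)]
  rw [Finset.card_filter, ← Finset.univ_product_univ, Finset.sum_product]
  refine Finset.sum_congr rfl fun t _ => ?_
  unfold Kset
  rw [Finset.card_filter]

/-! ### ★ Charged triples have three available cells -/

/-- ★ If the obligation of some captured `μ` does not vanish at the sorted triple `t = (a,b,c)`, then `t` has at least THREE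
available cells: the finite form evaluated at the even permutations `(a,b,c), (b,c,a), (c,a,b)` gives three equations each with a
nonzero term, and the three even transversals of the `3 × 3` grid are pairwise disjoint. [folklore] -/
theorem three_le_card_cells (U01 U02 U12 : Submodule ℂ (Fin 5 → Fin 5 → ℂ))
    (hm01 : ∀ u ∈ U01, ∀ x y : Fin 5, u x y ≠ 0 → monoMat x y ∈ U01)
    (hm02 : ∀ u ∈ U02, ∀ x y : Fin 5, u x y ≠ 0 → monoMat x y ∈ U02)
    (hm12 : ∀ u ∈ U12, ∀ x y : Fin 5, u x y ≠ 0 → monoMat x y ∈ U12)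
    (μ : Fin 5 → Fin 5 → ℂ) (hμ : contractZ μ ∈ L3 U01 U02 U12) (t : Tri)
    (ht : contractZ μ t.1.1 t.1.2.1 t.1.2.2 ≠ 0) : 3 ≤ (cells U01 U02 U12 t).card := by
  classical
  obtain ⟨⟨a, b, c⟩, hab, hbc⟩ := t
  simp only at ht hab hbc
  obtain ⟨A, B, C, hA, hB, hC, hT⟩ := L3_finite_form U01 U02 U12 hμ
  set T := contractZ μ with hTdef
  have h12 : ∀ p q r, T q p r = T p q r := fun p q r => contractZ_swap12 μ p q r
  have h23 : ∀ p q r, T p r q = T p q r := fun p q r => contractZ_swap23 μ p q r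
  -- the three even permutations carry the same nonzero value
  have e1 : T a b c = A c a b + B b a c + C a b c := hT a b c
  have e2 : T a b c = A a b c + B c b a + C b c a := by rw [← hT b c a, h23 b a c, h12 a b c]
  have e3 : T a b c = A b c a + B a c b + C c a b := by rw [← hT c a b, h12 a c b, h23 a b c]
  -- the complementary pairs of the three positions
  have hp0 : triPair ⟨(a, b, c), hab, hbc⟩ 0 = ⟨(b, c), hbc⟩ := by simp [triPair]
  have hp1 : triPair ⟨(a, b, c), hab, hbc⟩ 1 = ⟨(a, c), lt_trans hab hbc⟩ := by simp [triPair]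
  have hp2 : triPair ⟨(a, b, c), hab, hbc⟩ 2 = ⟨(a, b), hab⟩ := by simp [triPair]
  -- transversal 1: cells (2,2), (1,1), (0,0)
  have t1 : ((2 : Fin 3), (2 : Fin 3)) ∈ cells U01 U02 U12 ⟨(a, b, c), hab, hbc⟩ ∨
      ((1 : Fin 3), (1 : Fin 3)) ∈ cells U01 U02 U12 ⟨(a, b, c), hab, hbc⟩ ∨
      ((0 : Fin 3), (0 : Fin 3)) ∈ cells U01 U02 U12 ⟨(a, b, c), hab, hbc⟩ := by
    by_cases h1 : A c a b ≠ 0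
    · exact Or.inl (mem_cells_two (by rw [hp2]; exact hm01 _ (hA c) a b h1))
    by_cases h2 : B b a c ≠ 0
    · exact Or.inr (Or.inl (mem_cells_one (by rw [hp1]; exact hm02 _ (hB b) a c h2)))
    by_cases h3 : C a b c ≠ 0
    · exact Or.inr (Or.inr (mem_cells_zero (by rw [hp0]; exact hm12 _ (hC a) b c h3)))
    push Not at h1 h2 h3
    exact absurd (by rw [e1, h1, h2, h3, add_zero, add_zero]) ht
  -- transversal 2: cells (2,0), (1,2), (0,1)
  have t2 : ((2 : Fin 3), (0 : Fin 3)) ∈ cells U01 U02 U12 ⟨(a, b, c), hab, hbc⟩ ∨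
      ((1 : Fin 3), (2 : Fin 3)) ∈ cells U01 U02 U12 ⟨(a, b, c), hab, hbc⟩ ∨
      ((0 : Fin 3), (1 : Fin 3)) ∈ cells U01 U02 U12 ⟨(a, b, c), hab, hbc⟩ := by
    by_cases h1 : A a b c ≠ 0
    · exact Or.inl (mem_cells_two (by rw [hp0]; exact hm01 _ (hA a) b c h1))
    by_cases h2 : B c b a ≠ 0
    · refine Or.inr (Or.inl (mem_cells_one ?_))
      rw [hp2, monoMat_comm]; exact hm02 _ (hB c) b a h2
    by_cases h3 : C b c a ≠ 0
    · refine Or.inr (Or.inr (mem_cells_zero ?_))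
      rw [hp1, monoMat_comm]; exact hm12 _ (hC b) c a h3
    push Not at h1 h2 h3
    exact absurd (by rw [e2, h1, h2, h3, add_zero, add_zero]) ht
  -- transversal 3: cells (2,1), (1,0), (0,2)
  have t3 : ((2 : Fin 3), (1 : Fin 3)) ∈ cells U01 U02 U12 ⟨(a, b, c), hab, hbc⟩ ∨
      ((1 : Fin 3), (0 : Fin 3)) ∈ cells U01 U02 U12 ⟨(a, b, c), hab, hbc⟩ ∨
      ((0 : Fin 3), (2 : Fin 3)) ∈ cells U01 U02 U12 ⟨(a, b, c), hab, hbc⟩ := by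
    by_cases h1 : A b c a ≠ 0
    · refine Or.inl (mem_cells_two ?_)
      rw [hp1, monoMat_comm]; exact hm01 _ (hA b) c a h1
    by_cases h2 : B a c b ≠ 0
    · refine Or.inr (Or.inl (mem_cells_one ?_))
      rw [hp0, monoMat_comm]; exact hm02 _ (hB a) c b h2
    by_cases h3 : C c a b ≠ 0
    · exact Or.inr (Or.inr (mem_cells_zero (by rw [hp2]; exact hm12 _ (hC c) a b h3)))
    push Not at h1 h2 h3
    exact absurd (by rw [e3, h1, h2, h3, add_zero, add_zero]) ht
  rcases t1 with h1 | h1 | h1 <;> rcases t2 with h2 | h2 | h2 <;> rcases t3 with h3 | h3 | h3 <;>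
    exact three_le_card_of_mem (by decide) (by decide) (by decide) h1 h2 h3

/-! ### ★★ The monomial sector of the symmetric capture inequality -/

/-- ★★ **`CaptureIneqSym` HOLDS FOR MONOMIAL TRIANGLE SPANS (T2 of record).**  If `U₀₁, U₀₂, U₁₂` are spaces of symmetric matrices
each closed under passing to the pair indicators of its elements' nonzero entries (= spanned by pair/square indicators `monoMat x y`),
and `W` is a space of symmetric zero-diagonal leaf matrices with every obligation `contractZ μ` (`μ ∈ W`) in `L₃(U₀₁,U₀₂,U₁₂)`, then
`finrank W ≤ finrank U₀₁ + finrank U₀₂ + finrank U₁₂`. [folklore] -/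
theorem captureIneqSym_of_monomial (U01 U02 U12 W : Submodule ℂ (Fin 5 → Fin 5 → ℂ))
    (hs01 : ∀ u ∈ U01, ∀ p q : Fin 5, u p q = u q p) (hs02 : ∀ u ∈ U02, ∀ p q : Fin 5, u p q = u q p)
    (hs12 : ∀ u ∈ U12, ∀ p q : Fin 5, u p q = u q p)
    (hm01 : ∀ u ∈ U01, ∀ x y : Fin 5, u x y ≠ 0 → monoMat x y ∈ U01)
    (hm02 : ∀ u ∈ U02, ∀ x y : Fin 5, u x y ≠ 0 → monoMat x y ∈ U02)
    (hm12 : ∀ u ∈ U12, ∀ x y : Fin 5, u x y ≠ 0 → monoMat x y ∈ U12)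
    (hWs : ∀ μ ∈ W, ∀ s t : Fin 5, μ s t = μ t s) (hWd : ∀ μ ∈ W, ∀ s : Fin 5, μ s s = 0)
    (hWc : ∀ μ ∈ W, contractZ μ ∈ L3 U01 U02 U12) :
    Module.finrank ℂ W ≤ Module.finrank ℂ U01 + Module.finrank ℂ U02 + Module.finrank ℂ U12 := by
  classical
  -- the charged sorted triples
  set 𝒜 : Finset Tri := Finset.univ.filter (fun t : Tri => ∃ μ ∈ W, contractZ μ t.1.1 t.1.2.1 t.1.2.2 ≠ 0) with h𝒜
  -- (1) `W` injects into the functions on the charged triples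
  let Φ : W →ₗ[ℂ] (𝒜 → ℂ) :=
    { toFun := fun μ t => contractZ (μ : Fin 5 → Fin 5 → ℂ) t.1.1.1 t.1.1.2.1 t.1.1.2.2
      map_add' := by
        intro μ ν; funext t
        have h := congrFun (congrFun (congrFun (cZ.map_add (μ : Fin 5 → Fin 5 → ℂ) ν) t.1.1.1) t.1.1.2.1) t.1.1.2.2
        simpa only [cZ_apply, Pi.add_apply, Submodule.coe_add] using h
      map_smul' := by
        intro r μ; funext t
        have h := congrFun (congrFun (congrFun (cZ.map_smul r (μ : Fin 5 → Fin 5 → ℂ)) t.1.1.1) t.1.1.2.1) t.1.1.2.2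
        simpa only [cZ_apply, Pi.smul_apply, smul_eq_mul, Submodule.coe_smul, RingHom.id_apply] using h }
  have hΦ : Function.Injective Φ := by
    rw [injective_iff_map_eq_zero]
    intro μ hμ0
    have hsorted : ∀ t : Tri, contractZ (μ : Fin 5 → Fin 5 → ℂ) t.1.1 t.1.2.1 t.1.2.2 = 0 := by
      intro t
      by_cases ht : t ∈ 𝒜
      · have := congrFun hμ0 ⟨t, ht⟩
        exact this
      · by_contra hne
        exact ht (Finset.mem_filter.mpr ⟨Finset.mem_univ t, μ.1, μ.2, hne⟩)
    have hT : ∀ p q r, contractZ (μ : Fin 5 → Fin 5 → ℂ) p q r = 0 :=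
      eq_zero_of_sorted (fun p q r => contractZ_swap12 _ p q r) (fun p q r => contractZ_swap23 _ p q r)
        (fun p r => contractZ_rep12 _ p r) hsorted
    apply Subtype.ext
    refine hub_injective μ.1 (hWs μ.1 μ.2) (hWd μ.1 μ.2) fun p q => ?_
    simp [hT]
  have h1 : Module.finrank ℂ W ≤ 𝒜.card := by
    have := LinearMap.finrank_le_finrank_of_injective hΦ
    rwa [Module.finrank_fintype_fun_eq_card, Fintype.card_coe] at this
  -- (2) every charged triple has at least three cells
  have h2 : 𝒜.card * 3 ≤ ∑ t ∈ 𝒜, (cells U01 U02 U12 t).card := by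
    have := Finset.card_nsmul_le_sum 𝒜 (fun t => (cells U01 U02 U12 t).card) 3 (fun t ht => by
      obtain ⟨μ, hμ, hne⟩ := (Finset.mem_filter.mp ht).2
      exact three_le_card_cells U01 U02 U12 hm01 hm02 hm12 μ (hWc μ hμ) t hne)
    simpa using this
  -- (3) double counting of the cells
  have h3 : ∑ t ∈ 𝒜, (cells U01 U02 U12 t).card ≤
      3 * ((Finset.univ.filter (fun g : P => monoMat g.1.1 g.1.2 ∈ U12)).card +
        (Finset.univ.filter (fun g : P => monoMat g.1.1 g.1.2 ∈ U02)).card +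
        (Finset.univ.filter (fun g : P => monoMat g.1.1 g.1.2 ∈ U01)).card) := by
    calc ∑ t ∈ 𝒜, (cells U01 U02 U12 t).card
        ≤ ∑ t : Tri, (cells U01 U02 U12 t).card :=
          Finset.sum_le_sum_of_subset (Finset.subset_univ 𝒜)
      _ ≤ ∑ t : Tri, ((Kset U12 t).card + (Kset U02 t).card + (Kset U01 t).card) :=
          Finset.sum_le_sum fun t _ => card_cells_le U01 U02 U12 t
      _ = 3 * ((Finset.univ.filter (fun g : P => monoMat g.1.1 g.1.2 ∈ U12)).card +
            (Finset.univ.filter (fun g : P => monoMat g.1.1 g.1.2 ∈ U02)).card +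
            (Finset.univ.filter (fun g : P => monoMat g.1.1 g.1.2 ∈ U01)).card) := by
          rw [Finset.sum_add_distrib, Finset.sum_add_distrib, sum_card_Kset, sum_card_Kset, sum_card_Kset]
          ring
  -- (4) pair indicators are independent
  have h4a := card_monoMat_mem_le_finrank U01 hs01
  have h4b := card_monoMat_mem_le_finrank U02 hs02
  have h4c := card_monoMat_mem_le_finrank U12 hs12
  omega

end

end LaplaceFiveSeparatedCapture

end Summit.ValiantsHypothesis.ValiantsHypothesis.Theorems.RigidityForcesSymmetryRankRigidMinimalRepr
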